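import Summits.BirchSwinnertonDyer.BirchSwinnertonDyer.Theorems.EisensteinPrimesResidualDevissageNonsplitLocalData
import Summits.BirchSwinnertonDyer.BirchSwinnertonDyer.Theorems.UniversalToricDescentSigmaLocalStabilizer
import Literature.NumberTheory.EllipticCurves.ZpExtensionDecompositionAbovePProofs
import HarnessLib

/-!
# Crux `GoodLatticeBDPValue` (stmt-BirchSwinnertonDyer-19032), line `halves` v20, stub `stub_indexInputs`:
# the (R) conjuncts (`hτ`, `hdist`, `hreps`) AT THE EXACT EXPONENT `κ(D_v̄) = p^c ℤ_p` and `τ i = γ^i`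

Width seat bsd-line-x1-p1-w5 (gen 0, 2026-08-28), glue helper for the LEAD's v20 `stub_indexInputs` (ONE
existential package `∃ c τ …` shared by the (R) conjuncts and by the SUR conjuncts). The tree produces the two
halves with DIFFERENT bookkeeping of the exponent `c` = `log_p` of the number of places of `K_∞` above `v̄`:

* Brink's representatives `ResidualDevissageNonsplitLocalData.exists_reps_distinct_places` (x2-p2) return
  `∃ c, hdist ∧ ∀ M τ, hτ → hreps` with `c` HIDDEN behind the existential (internally: the minimal valuation on
  `κ(D_v̄)`);
* the SUR inputs S1/S2 of seat w3 (`AcTwistDeformation.char_/curve_forall_fin_exists_unramifiedOutside_resOfLe_conjH1_pow_eq`,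
  p647873) hold for ANY `c` with `κ(D_v̄) = p^c ℤ_p` EXACTLY — `hc : ∃ δ ∈ D_v̄, κ δ = p^c` and
  `hcd : ∀ δ ∈ D_v̄, p^c ∣ κ δ` — and for the representatives `τ i = γ^i` of a topological generator `γ`.

This file puts (R) in the second currency, so that ONE `c` and ONE `τ = (γ ^ ·)` serve all of (R) and SUR:
* `apply_pow_eq_ofAdd_natCast` — `κ(γ^i) = i` (`hτ` for `τ i = γ^i`);
* `pairwise_ne_mul_of_forall_pow_dvd` — `hdist` at ANY `c` with `hcd` (pure arithmetic in `ℤ_p`: a difference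
  `j − i` with `0 < |j − i| < p^c` is not divisible by `p^c`);
* `resOfLe_conjH1_eq_zero_of_reps_of_pow_generates` — `hreps` at any `c` with `hc`, for every discrete module
  `M` and every `τ` with `κ(τ i) = i`: Brink's `c'` satisfies `c' ≤ c` (else `hdist'` fails at `(0, p^c)` against
  the `δ₀` of `hc`), so fewer vanishing hypotheses are needed than given;
* `exists_pow_generates_decomp_of_isImaginaryQuadratic` — at the crux's data (`K` imaginary quadratic,
  `vbar ∋ p`, ANY `ℤ_p`-extension `κ`) such an exact exponent exists (`D_v̄ ⊄ ker κ`: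
  `ZpExtension.not_decomp_le_kerSubgroup_of_isImaginaryQuadratic`; closed image:
  `UniversalToricDescentSigmaLocalStabilizer.exists_pow_and_forall_dvd_of_not_le`);
* `reps_package_of_pow_generates` — the three (R)-shaped conjuncts of `stub_indexInputs` bundled, for
  `τ = (γ ^ ·)` and any exact `c`, quantified over the module (instantiate at `(F/𝒪)(θsub)`, `E_K[p^∞]`,
  `(F/𝒪)(θquot)`).

No new definition, no named fact, no `sorry`; no statement of the crux / KY Thm. 1.4.1 is proved here.

References: Brink, *Canad. Math. Bull.* 50 (2007) (finitely many places above `v̄`); Washington, *Introduction to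
Cyclotomic Fields*, §13.1; Keller–Yin, arXiv:2402.12781v2, Rem. 1.2.3 (ii) and Rem. 1.4.2.
-/

-- D-0017: single-problem summit, the namespace repeats the problem name by design.
set_option linter.dupNamespace false
set_option autoImplicit false

noncomputable section

open scoped Classical

open NumberField IsDedekindDomain Field Multiplicative
open Literature.NumberTheory.EllipticCurves Literature.NumberTheory.EllipticCurves.GreenbergSelmer
  Literature.NumberTheory.GaloisRepresentations IsDedekindDomain.HeightOneSpectrum

namespace Summit.BirchSwinnertonDyer.BirchSwinnertonDyer.Theorems.IndexInputsReps

open Summit.BirchSwinnertonDyer.BirchSwinnertonDyer.Theorems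

variable {K : Type} [Field K] [NumberField K] {p : ℕ} [Fact p.Prime] (κ : ZpExtension K p)

omit [NumberField K] in
/-- **`κ(γ^i) = i`** for a topological generator `γ` (`κ γ = 1`): the representatives `τ i = γ^i` satisfy the
`hτ` conjunct `κ (τ i) = Multiplicative.ofAdd (i : ℤ_p)` of `stub_indexInputs`.
[cite: Washington1997, §13.2 (`T = γ − 1`)] -/
theorem apply_pow_eq_ofAdd_natCast {γ : absoluteGaloisGroup K} (hγ : κ.IsTopGenerator γ) (i : ℕ) :
    κ (γ ^ i) = Multiplicative.ofAdd ((i : ℕ) : ℤ_[p]) := by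
  rw [map_pow, show κ γ = Multiplicative.ofAdd 1 from hγ, ← ofAdd_nsmul, nsmul_one]

omit [NumberField K] in
/-- **`hdist` at any exponent dividing `κ` on `D`**: if `p^c ∣ κ(δ)` for every `δ ∈ D`, then for
`i ≠ j < p^c` and `δ ∈ D` one has `j ≠ i + κ(δ)` in `ℤ_p` — the classes `i + κ(D)`, `i < p^c`, are pairwise
distinct (`j − i` is a non-zero integer of absolute value `< p^c`, so not in `p^c ℤ_p`). With `D = D_v̄` and
`κ(τ i) = i`: the `τ i` lie at pairwise distinct places of `K_∞` above `v̄`.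
[cite: Washington1997, §13.1] -/
theorem pairwise_ne_mul_of_forall_pow_dvd (D : Subgroup (absoluteGaloisGroup K)) {c : ℕ}
    (hcd : ∀ δ ∈ D, (p : ℤ_[p]) ^ c ∣ (κ δ).toAdd) :
    ∀ i j : ℕ, i < p ^ c → j < p ^ c → i ≠ j → ∀ δ ∈ D,
      Multiplicative.ofAdd ((j : ℕ) : ℤ_[p]) ≠ Multiplicative.ofAdd ((i : ℕ) : ℤ_[p]) * κ δ := by
  intro i j hi hj hij δ hδD heq
  have hδ : (κ δ).toAdd = ((j : ℕ) : ℤ_[p]) - (i : ℕ) := by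
    have h := congrArg Multiplicative.toAdd heq
    rw [toAdd_mul, toAdd_ofAdd, toAdd_ofAdd] at h
    linear_combination (-1 : ℤ_[p]) * h
  have hspan : ((j : ℕ) : ℤ_[p]) - (i : ℕ) ∈ (Ideal.span {(p : ℤ_[p]) ^ c} : Ideal ℤ_[p]) := by
    rw [Ideal.mem_span_singleton, ← hδ]
    exact hcd δ hδD
  have hcongr : ((j : ℕ) : ZMod (p ^ c)) = ((i : ℕ) : ZMod (p ^ c)) :=
    PadicInt.zmod_congr_of_sub_mem_span c ((j : ℕ) : ℤ_[p]) j i (by simp) hspan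
  have hval_eq : ((j : ℕ) : ZMod (p ^ c)).val = ((i : ℕ) : ZMod (p ^ c)).val := by rw [hcongr]
  rw [ZMod.val_natCast, ZMod.val_natCast, Nat.mod_eq_of_lt hj, Nat.mod_eq_of_lt hi] at hval_eq
  exact hij hval_eq.symm

/-- **`hreps` at the exact exponent.** Let `v` be a finite place and `c` an exponent ATTAINED by `κ` on
`D_v` (`κ δ₀ = p^c` for some `δ₀ ∈ D_v`; in particular `v` is finitely decomposed in `K_∞`). Then for
every discrete `Γ_K`-module `M` and representatives `τ` with `κ(τ i) = i`, a class `x ∈ H¹(ker κ, M)` whose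
conjugates `conj_{τ i} x`, `i < p^c`, all die on `ker κ ⊓ D_v` has ALL its conjugates `conj_σ x` dying there.
Proof: Brink's representatives theorem (`exists_reps_distinct_places`) gives this for its own exponent `c'`
(the minimal valuation on `κ(D_v)`), and `c' ≤ c` because `p^c = κ(δ₀) ∈ κ(D_v)` would otherwise violate the
distinctness of the classes `0 + κ(D_v)` and `p^c + κ(D_v)` below `p^{c'}`.
[cite: GreenbergLNM1716, §1 ("finitely decomposed")] [cite: Washington1997, §13.1] -/
theorem resOfLe_conjH1_eq_zero_of_reps_of_pow_generates (v : HeightOneSpectrum (𝓞 K)) {c : ℕ}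
    (hc : ∃ δ ∈ decomp (K := K) v, (κ δ).toAdd = (p : ℤ_[p]) ^ c)
    (M : Type) [AddCommGroup M] [DistribMulAction (absoluteGaloisGroup K) M] [TopologicalSpace M]
    [DiscreteTopology M] (τ : ℕ → absoluteGaloisGroup K)
    (hτ : ∀ i, κ (τ i) = Multiplicative.ofAdd ((i : ℕ) : ℤ_[p]))
    (x : subgroupH1 κ.kerSubgroup M)
    (hx : ∀ i, i < p ^ c →
      resOfLe M (inf_le_left : κ.kerSubgroup ⊓ decomp v ≤ κ.kerSubgroup) (conjH1 κ.kerSubgroup M (τ i) x) = 0)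
    (σ : absoluteGaloisGroup K) :
    resOfLe M (inf_le_left : κ.kerSubgroup ⊓ decomp v ≤ κ.kerSubgroup) (conjH1 κ.kerSubgroup M σ x) = 0 := by
  have hp : p.Prime := Fact.out
  obtain ⟨δ₀, hδ₀D, hδ₀⟩ := hc
  -- `v` is finitely decomposed: `κ δ₀ = p^c ≠ 0`
  have hv : ¬ (decomp v ≤ κ.kerSubgroup) := fun hle ↦ by
    have h1 : κ δ₀ = 1 := ZpExtension.mem_kerSubgroup.mp (hle hδ₀D)
    have h0 : (p : ℤ_[p]) ^ c = 0 := by rw [← hδ₀, h1, toAdd_one]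
    exact pow_ne_zero c PadicInt.irreducible_p.ne_zero h0
  obtain ⟨c', hdist', hreps'⟩ := ResidualDevissageNonsplitLocalData.exists_reps_distinct_places κ v hv
  -- Brink's exponent is at most `c`
  have hle : c' ≤ c := by
    refine le_of_not_gt fun hlt ↦ ?_
    have hj : p ^ c < p ^ c' := Nat.pow_lt_pow_right hp.one_lt hlt
    refine hdist' 0 (p ^ c) (pow_pos hp.pos _) hj (pow_pos hp.pos _).ne δ₀ hδ₀D ?_
    apply Multiplicative.toAdd.injective
    rw [toAdd_mul, toAdd_ofAdd, toAdd_ofAdd, hδ₀]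
    push_cast
    ring
  exact hreps' M τ hτ x (fun i hi ↦ hx i (lt_of_lt_of_le hi (Nat.pow_le_pow_right hp.pos hle))) σ

/-- **The exact exponent exists above `p` for an imaginary quadratic `K`**: for ANY `ℤ_p`-extension `κ` of an
imaginary quadratic `K` and any `vbar ∋ p`, `D_{v̄} ⊄ ker κ`
(`ZpExtension.not_decomp_le_kerSubgroup_of_isImaginaryQuadratic`), so `κ(D_v̄) = p^c ℤ_p` for exactly one `c`:
some `δ ∈ D_v̄` has `κ δ = p^c` and `p^c ∣ κ δ` on `D_v̄` (the image of the compact `D_v̄` is a non-zero closed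
subgroup = ideal of `ℤ_p`; `UniversalToricDescentSigmaLocalStabilizer.exists_pow_and_forall_dvd_of_not_le`).
[cite: Washington1997, §13.1] [cite: KellerYin2024, Rem. 1.2.3 (ii) (arXiv:2402.12781v2 TeX L690–712)] -/
theorem exists_pow_generates_decomp_of_isImaginaryQuadratic (hK : IsImaginaryQuadratic K)
    {vbar : HeightOneSpectrum (𝓞 K)} (hvbar : ((p : ℕ) : 𝓞 K) ∈ vbar.asIdeal) :
    ∃ c : ℕ, (∃ δ ∈ decomp (K := K) vbar, (κ δ).toAdd = (p : ℤ_[p]) ^ c) ∧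
      ∀ δ ∈ decomp (K := K) vbar, (p : ℤ_[p]) ^ c ∣ (κ δ).toAdd := by
  have hdec : ¬ decomp (K := K) vbar ≤ κ.kerSubgroup :=
    ZpExtension.not_decomp_le_kerSubgroup_of_isImaginaryQuadratic hK κ hvbar
  obtain ⟨c, ⟨d₀, hd₀⟩, -, hdvd⟩ :=
    UniversalToricDescentSigmaLocalStabilizer.exists_pow_and_forall_dvd_of_not_le κ vbar hdec
  exact ⟨c, ⟨d₀, d₀.2, hd₀⟩, fun δ hδ ↦ hdvd ⟨δ, hδ⟩⟩

/-- **The (R) conjuncts of `stub_indexInputs`, bundled, at `τ = (γ ^ ·)` and any exact exponent `c`** (the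
currency of w3's SUR inputs p647873): `hτ : ∀ i, κ (γ^i) = i`, `hdist` on `D_v̄` below `p^c`, and `hreps`
for EVERY discrete `Γ_K`-module `M` (instantiate at `(F/𝒪)(θsub)`, `E_K[p^∞]`, `(F/𝒪)(θquot)` for
`hreps₁ hreps₂ hreps₃`). [cite: GreenbergLNM1716, §1 ("finitely decomposed")] [cite: Washington1997, §13.1–13.2] -/
theorem reps_package_of_pow_generates (v : HeightOneSpectrum (𝓞 K)) {γ : absoluteGaloisGroup K}
    (hγ : κ.IsTopGenerator γ) {c : ℕ}
    (hc : ∃ δ ∈ decomp (K := K) v, (κ δ).toAdd = (p : ℤ_[p]) ^ c)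
    (hcd : ∀ δ ∈ decomp (K := K) v, (p : ℤ_[p]) ^ c ∣ (κ δ).toAdd) :
    (∀ i : ℕ, κ ((fun i : ℕ ↦ γ ^ i) i) = Multiplicative.ofAdd ((i : ℕ) : ℤ_[p])) ∧
      (∀ i j : ℕ, i < p ^ c → j < p ^ c → i ≠ j → ∀ δ ∈ decomp (K := K) v,
        Multiplicative.ofAdd ((j : ℕ) : ℤ_[p]) ≠ Multiplicative.ofAdd ((i : ℕ) : ℤ_[p]) * κ δ) ∧
      ∀ (M : Type) [AddCommGroup M] [DistribMulAction (absoluteGaloisGroup K) M] [TopologicalSpace M]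
        [DiscreteTopology M] (x : subgroupH1 κ.kerSubgroup M),
        (∀ i, i < p ^ c → resOfLe M (inf_le_left : κ.kerSubgroup ⊓ decomp v ≤ κ.kerSubgroup)
          (conjH1 κ.kerSubgroup M ((fun i : ℕ ↦ γ ^ i) i) x) = 0) →
        ∀ σ : absoluteGaloisGroup K,
          resOfLe M (inf_le_left : κ.kerSubgroup ⊓ decomp v ≤ κ.kerSubgroup) (conjH1 κ.kerSubgroup M σ x) = 0 :=
  ⟨apply_pow_eq_ofAdd_natCast κ hγ, pairwise_ne_mul_of_forall_pow_dvd κ (decomp (K := K) v) hcd,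
    fun M _ _ _ _ x hx σ ↦ resOfLe_conjH1_eq_zero_of_reps_of_pow_generates κ v hc M (fun i : ℕ ↦ γ ^ i)
      (apply_pow_eq_ofAdd_natCast κ hγ) x hx σ⟩

end Summit.BirchSwinnertonDyer.BirchSwinnertonDyer.Theorems.IndexInputsReps

end
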